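import Mathlib
import HarnessLib
import HarnessLib.Audit
import Summits.AtomisticToContinuum.Statement
import Literature.MathematicalPhysics.QuantumManyBody.PeriodicBoseGas
import Literature.MathematicalPhysics.QuantumManyBody.PeriodicBoseGasFourier
import HarnessLib.Audit.Status.Attr

/-!
Route: BECPhononFloor

# Route BECPhononFloor — no shoulder below the healing length — a constant-free phonon floor on
momentum-shell occupations makes TL-BEC a shell count

It suffices to show X = PhononFloor ∧ MesoscopicTail for near-minimisers of the PERIODIC N-body
energy on the torus of side L = (N/ρ)^{1/3} (card slope-floors-phonon-window: K1 in cube-shell form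
+ its P4 energy side); the shared crux BoundaryTransferWeak (stmt-AtomisticToContinuum-0827) then
carries torus BEC to the Dirichlet conjunct. PhononFloor: for every repulsive finite-range v there
are K, C, ρ₀ > 0 such that for 0 < ρ < ρ₀, all large N, some δ > 0 and every δ-near-minimiser Ψ, the
THIN-CUBE-SHELL OCCUPATIONS S_Ψ(r) := Σ_{n ∈ ℤ³, |n|_∞ = r} ⟨φ_n, γ_Ψ φ_n⟩ (φ_n = L^{-3/2} e^{2πi
n·x/L}) satisfy S_Ψ(r) ≤ C·S_Ψ(s) + 1 for all 1 ≤ r ≤ s ≤ K L√ρ/2π. In d = 3 (S(r) ≈ 24 r² n̄(r))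
this is exactly the card's order-2 floor "the modal kinetic energy |k|² n̄(k) does not decrease
across the phonon window 2π/L ≤ |k| ≤ K√ρ = θ√(ρa)": an ORDER relation among the state's own
occupations — no n₀, no L, no absolute infrared constant; the +1 (one particle) only regularises
exactly-empty shells (v = 0). MesoscopicTail: for every K₀, ε > 0, at small density all but εN
particles of a near-minimiser occupy plane waves with |n|_∞ < K₀ L√ρ/2π. FloorModeCounting (support)
turns PhononFloor ∧ MesoscopicTail into constant-mode condensation ≥ N/2 on the torus (the
PeriodicBEC body of stmt-AtomisticToContinuum-0826) by a finite shell count.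
Lean: `PhononFloor ∧ MesoscopicTail ∧ BoundaryTransferWeak`

## Assembly
Pure logic (rc 0 in Sketch.lean; axioms propext / Classical.choice / Quot.sound): fix v repulsive
finite-range; PhononFloor and MesoscopicTail give their bodies for v; FloorModeCounting turns them
into the PeriodicBEC body for v; BoundaryTransferWeak gives ∃ρ₀ ∀ρ<ρ₀ HasGroundStateBEC v ρ, i.e.
the sub-problem Statement decl `BoseEinsteinCondensation` (abbrev of the Literature conjecture).
Deciding theorem (glue.lean): `theorem closes (h1 : PhononFloor) (h2 : MesoscopicTail) (h3 :
FloorModeCounting) (h4 : BoundaryTransferWeak) : BoseEinsteinCondensation := fun v hv => h4 v hv (h3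
v hv (h1 v hv) (h2 v hv))`.

Rationale: WHY THIS LINE. The infrared is carried not by a BOUND n_k ≤ C_abs/k² valid down to k = 2π/L (the
absolute constant that only reflection positivity has ever supplied, KennedyLiebShastry1988) but by
an ORDER relation among the near-minimiser's own shell occupations, which transports whatever
occupation LEVEL sits at the healing scale down to the lowest shell; in d = 3 this transport is free
because the ≈ R/2 infrared shells are each dominated by C times the average of the ≈ R/2 reference
shells in [R/2, R] (the card's "transport factor R²Σ_{0<|n|<R}|n|⁻²/#shell(R) = O(1) iff d > 2",
here reduced to a pigeonhole over thin cube shells). The level at the healing scale is asked of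
ENERGY only where energy methods are already theorems of the tree: MesoscopicTail is GP-scale (ℓ =
Gξ, g = ρaℓ² fixed) Neumann localisation of the torus near-minimiser from the PROVED facts
LSSY2005_lowerBound_neumann_holds / LSSY2005_upperBound_periodic_holds / LSSY2005_lemma41_holds /
LSSY2005_lemma52_periodic_holds / Fournais2020_condensation_holds (LSSY2005 Thms 2.2, 2.4, Lemmas
4.1, 5.2; Fournais2020 Thm 1.2; Junge2026, ChongLiangNam2026 for the Neumann technology) plus an
elementary Fourier-tail lemma for piecewise-constant coarse-graining, so the only new input is
PhononFloor — precisely the piece to which energy is blind by O(N/L²). Anchors (numbers, § Numbers /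
§ Cheapest falsifier): Bogoliubov's modal kinetic energy x·n(x) is unimodal with peak EXACTLY at E_k
= μ (x* = √2 − 1) and its thin-cube-shell occupation S(r) is increasing through the window (worst
ratio 1.000 / 1.018 / 1.252 for θ = 2 / 3.2 / 5 at L = 60–240 ξ, S(1) ∝ L); Gavoret–Nozières n_k →
n₀mc/2|k| (GavoretNozieres1964, Griffin1993 §6.3, NepomnyashchiiNepomnyashchii1978 for the
log-dressing of Σ₁₂ that leaves the leading law intact) over-determines the floor in the deep
infrared, while every catalogued energy-blind impostor (Galilei boosts, number filters, Maxwellian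
quasi-condensates n = Me^{−Sk²}) has an infrared SHOULDER and violates it by ratios → ∞. Imported
from elsewhere: only lattice-point counting; the novelty is the logical type of the infrared input
(card; refuter triage-22: "the COUNT is in-pool, the delta is the INPUT's logical type"). What prior
routes do not do: BECIroning, BECInfraredBound, BECLaplacianL1, BECThomsonPrinciple,
BECSectorPoincareTwoScale and BECGroundStateSOS all want an infrared BOUND with a constant (exponent
1 or 2) down to 2π/L, BECPhononTransport (closed) paid the far field with the f-sum rule; here no
constant is manufactured, energy enters only above K₀√ρ, and the card's K2 (two-sided LHY for
deformed dispersions, not in print) is replaced by in-tree GP-scale localisation.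

RANKED CRUXES. #2 PhononFloor (crux) — (card K1, thin-cube-shell form recommended by triage-22) for
every repulsive finite-range radial v there are K > 0 (physically K = θ√a, θ ≲ 3.2 ⟺ E_k ≤ μ at the
window top), C > 0 and ρ₀ > 0 such that for all 0 < ρ < ρ₀, eventually in N, there is δ > 0 with:
every periodic C¹ trial state Ψ on the torus of side L = (N/ρ)^{1/3} with periodicEnergy v Ψ ≤
E₀^per(N, L) + δ satisfies, for all integers 1 ≤ r ≤ s with s ≤ K L√ρ/(2π), Σ_{|n|_∞ = r} n_Ψ(n) ≤ C
· Σ_{|n|_∞ = s} n_Ψ(n) + 1, where n_Ψ(n) = ⟨φ_n, γ_Ψ φ_n⟩ = cellOccupation of L^{-3/2} cellWave L n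
and {|n|_∞ = r} = cube(r) \ cube(r−1). δ is chosen AFTER N (an exact-ground-state property; below
the Galilei-boost witnesses); the +1 absorbs exactly-empty shells (v = 0 a.e.: T ≤ δ makes every
shell ≤ 1). Bogoliubov-consistent with C = 2 for θ ≤ 3.2 including the factor ≤ 3.25 of sup-norm
shell geometry (§ Cheapest falsifier). [difficulty: open-problem] (why it might fail:
Exact-ground-state infrared shape law, open beyond Bogoliubov: an L-growing pile-up in the lowest
cube shells relative to the healing-scale shells (quasi-condensate / type-III condensation between ξ
and L), or an unbounded Nepomnyashchii-type log-dressing across the window, breaks it.)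
[GavoretNozieres1964, Griffin1993, NepomnyashchiiNepomnyashchii1978, PitaevskiiStringari1991,
PuleZagrebnov2004, LSSY2005, arXiv:2011.10869, doi:10.1103/physreva.56.1414]
#3 MesoscopicTail (crux) — (card P4, the energy side; ∀ε-form needed by the count) for every
repulsive finite-range radial v and all K₀ > 0, ε > 0 there is ρ₀ > 0 such that for all 0 < ρ < ρ₀,
eventually in N, there is δ > 0 with: every periodic δ-near-minimiser Ψ on the torus of side L =
(N/ρ)^{1/3} has Σ_{n ∈ cube(M) \ cube(m)} n_Ψ(n) ≤ εN for all integers m, M with m + 1 ≥ K₀ L√ρ/(2π)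
— i.e. the plane waves with (2π/L)|n|_∞ ≥ K₀√ρ (a fixed fraction K₀/√(8πa) of the inverse healing
length and everything above, UV included) carry at most εN particles. Intended proof from PROVED
cone facts only: Neumann-bracket the torus into boxes of side ℓ = Gξ, G = G(K₀, a, ε) fixed (GP
scale, g = ρaℓ² = G²/8π); global energy ≤ 4πρ₁aN(1 + C a/b) (LSSY2005_upperBound_periodic_holds)
against Σ_boxes LSSY2005_lowerBound_neumann_holds with LY superadditivity (2.52)–(2.64) ⟹ Σ_B (n_B −
ρℓ³)² and Σ_B (local excess) are o(ρaN)·ℓ³/a-controlled; LSSY Lemma 4.1 + 5.2 per box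
(lemma41_holds, lemma52_periodic_holds; Fournais2020_condensation_holds beyond) ⟹ Σ_B tr(Q_B γ_Ψ) ≤
(G²/2c)(Y^{1/17} + a/b)N; finally Σ_{|n|_∞ ≥ m+1} n_Ψ ≤ 2‖Π_{≥K₀√ρ} E_ℓ‖²·N + 2 Σ_B tr(Q_B γ_Ψ) with
‖Π_{≥K} E_ℓ‖² ≤ 4/(πKℓ) for the coarse-graining E_ℓ onto ℓ-box constants. v = 0 a.e.: T ≤ δ gives
the bound directly (δ after N). [difficulty: L] (why it might fail: Needs condensation LOCALISED to
GP-scale Neumann sub-boxes of a canonical torus near-minimiser uniformly over boxes with atypical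
particle number (ℓ² control of n_B via LY superadditivity); Lemma 5.2 / Thm 5.1 are vendored
periodic — the Neumann sub-box form with fluctuating n_B is not in print.) [LSSY2005, Fournais2020,
Junge2026, ChongLiangNam2026, LiebSeiringer2002, arXiv:2510.20493, arXiv:2603.20776]
#4 BoundaryTransferWeak (crux) — (shared verbatim with stmt-AtomisticToContinuum-0827, routes
BECIroning / BECLaplacianL1 / BECGroundStateSOS / BECStronglyRayleigh …) for each repulsive
finite-range v, the PeriodicBEC body for v (torus of side (N/ρ)^{1/3}, constant-mode occupation ≥ cN
for δ-near-minimisers, all small ρ) implies ∃ρ₀ > 0 ∀ρ ∈ (0, ρ₀) HasGroundStateBEC v ρ (Dirichlet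
box, λ_max(γ) ≥ cN via condensateNumber). Not glue: near-minimiser slacks are O(N/L²) while
Dirichlet/periodic energies differ by a wall term ≫ N/L²; expected route: Neumann bracketing of
interior sub-boxes + a mode-free criterion (λ_max ≥ tr γ²/N). v ≡ 0: hypothesis and conclusion both
true. [difficulty: L] (why it might fail: The torus hypothesis never fires on the Dirichlet ground
state (wall energy ≫ δ above E₀^per; interior restrictions are neither periodic nor sharp-N): no
energy-comparison proof; needs a structural transfer (Neumann bracketing + mode-free λ_max ≥ tr
γ²/N) not in print.) [LSSY2005, BoccatoSeiringer2023, Basti2022, Junge2026, Robinson1976,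
Fournais2020]
#9 FloorModeCounting (support) — for each repulsive finite-range v: [PhononFloor body for v] →
[MesoscopicTail body for v] → [PeriodicBEC body for v, c = 1/2] (stmt-0826 shape = the hypothesis of
BoundaryTransferWeak). Proof on paper, every input in tree: take K, C from PhononFloor, apply
MesoscopicTail with K₀ = K/2 and ε = 1/(8(2C + 1)), intersect the eventual-N sets and take δ =
min(δ₁, δ₂). Put R = K L√ρ/2π (≥ 4 eventually; = 0 if the floor window is void, then MesoscopicTail
alone bounds Σ_{n≠0}), m = ⌈R/2⌉ − 1, W = {m+1, …, ⌊R⌋} (#W ≥ R/2 − 1). (1) Infrared shells 1 ≤ r ≤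
m: PhononFloor against each s ∈ W and averaging over W gives S(r) ≤ (C/#W) Σ_{s∈W} S(s) + 1 ≤
(C/#W)·εN + 1 (the W-shells lie in cube(⌊R⌋) \ cube(m), bounded by MesoscopicTail), hence Σ_{r≤m}
S(r) ≤ 2CεN + m. (2) Everything with |n|_∞ > m: ≤ εN by MesoscopicTail, uniformly in the outer
cutoff M. (3) Parseval per particle slice (tsum_sq_cellFourierCoeff of PeriodicBoseGasFourier;
Tonelli): Σ_{n ∈ ℤ³} n_Ψ(n) = N, and n_Ψ(0) = condensateOccupation (cellWave_zero). Hence n₀ ≥ N −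
(2C+1)εN − m ≥ N − N/8 − m ≥ N/2 eventually (m = O(N^{1/3})). Heavy but routine Lean (Finset cube
shells, ENNReal bookkeeping, tsum/Finset splitting); no open mathematics. [difficulty: provable-now]
[LSSY2005, KennedyLiebShastry1988, Fournais2020]

TWO-LAYER PLAN. Foreseen glued splits (k ≤ 3, depth 1; nothing filed now). PhononFloor ⇐ one of the
card's three devices once one acquires an estimate: (LC) ShellLogConcavity [j ↦ log S(2^j) concave
up to a constant on dyadic shells — "no shoulder"] → TopShellLevel [S does not decrease at the
window top, an energy statement one scale above MesoscopicTail] → PhononFloor; or (S)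
StieltjesWindow [γ̂_Ψ restricted to the infrared window is a Stieltjes transform in k² up to a UV
remainder ⟹ k²n̄ non-decreasing; unlike complete monotonicity this cone excludes the Maxwellian] →
PhononFloor; or (V) ReshelvingExchange [compare the near-minimiser with its k ↦ 2k reshelved
competitor in the P = 0 sector] → PhononFloor. MesoscopicTail ⇐ LocalisedDepletion [Σ_B tr(Q_B γ_Ψ)
≤ εN over GP-scale Neumann boxes ℓ = Gξ, LY superadditivity + Lemma 4.1/5.2 per box] → FourierTail
[Σ_{|n|_∞ ≥ m+1} n_Ψ ≤ 2‖Π_{≥K}E_ℓ‖²N + 2Σ_B tr(Q_Bγ_Ψ), ‖Π_{≥K}E_ℓ‖² ≤ 4/(πKℓ)] → MesoscopicTail (k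
= 2). Sharper alternative child for MesoscopicTail if the localisation bookkeeping stalls: the
card's K2 ParticleWindowDepletion (≤ D·N√(ρa³) particles in θ₁√(ρa) ≤ |k| ≤ M√(ρa), by two-sided
LHY-order asymptotics for deformed dispersions ε_k(1 ± t·w(kξ)) + Hellmann–Feynman/concavity in t;
FournaisSolovej2020, YauYin2009, BastiCenatiempoSchlein2021, arXiv:2011.10869 §3.4) together with
KineticTail (Chebyshev on T ≤ 4πρ₁aN(1 + Ca/b), in tree) → MesoscopicTail. BoundaryTransferWeak:
decomposition owned by the periodic-reduction programme, not split here.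

KILL CRITERIA. ¬PhononFloor — exact torus ground states at arbitrarily small ρ whose lowest cube
shells hold an L-GROWING multiple of the healing-scale shell occupations (a quasi-condensate
shoulder between ξ and L, i.e. generalised type-II/III condensation in the cube) — closes the route
`refuted:PhononFloor`; the witness is of independent interest and bears on every exponent-2 infrared
line (BECIroning's IroningShellBound). A refutation showing only that the PURE ratio (without +1, or
pointwise per mode) fails is a misstatement signal: restate shell-averaged over dyadic blocks.
¬MesoscopicTail would contradict GP-scale localised condensation, which is a theorem: it can only
mean a misformalised clause — restate, or pivot to the card's K2 (ParticleWindowDepletion +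
KineticTail). ¬BoundaryTransferWeak kills this route together with BECIroning / BECLaplacianL1 /
BECGroundStateSOS / BECStronglyRayleigh (walls destroy a torus condensate), not the conjunct; pivot:
Dirichlet-native sine-mode shells. PeriodicBEC (stmt-0826 body) proved by any route moots ranks 2–3
for the assembly (close `superseded`) but leaves PhononFloor as a quantitative statement of
independent interest.

NOT DECOMPOSED YET. The proof devices for PhononFloor ((LC)/(S)/(V) above — none has an estimate
yet; they are the research content of rank 2); the per-box bookkeeping of atypical particle numbers,
the Neumann form of Lemma 5.2 and the Fourier-tail lemma inside MesoscopicTail (children only if a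
prover asks); Parseval-per-slice and the finite shell sums inside FloorModeCounting (attached with
`--supports`, never items); uniqueness of the torus ground state and the compactness passage exact
ground state ⇒ δ-near-minimisers at fixed (N, L) (finitely many shells matter). Hard cores need
nothing special (all cited cone facts allow v = ⊤·1_{[0,a]}). No T > 0, no d ≠ 3, canonical torus
only; the card's all-shape TanFloor variant (order 4 up to M/ξ) is a separate thesis, not filed.

CHEAPEST FALSIFIER. (i) Bogoliubov, done here (folder bogoliubov_shells.py, units ξ = 1):
thin-cube-shell occupations S(r) on tori L = 60 / 120 / 240 ξ are increasing through the phonon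
window; worst S(r)/S(s) over 1 ≤ r ≤ s ≤ R is 1.000 at θ = 2, 1.018 at θ = 3.2 (Euclidean top of the
sup-norm shell at kξ = 1.1), 1.252 at θ = 5; S(1) = 52.5 / 116.5 / 245.3 ∝ L; x·n(x) peaks at x =
0.4142 = √2 − 1 with E = 1.000 μ. So (C, θ) = (2, 3.2) is consistent with room. (ii) The card's
census (kit j002543 small / j002211 full, queued by the card author; hard-core-boson ED on 4³–6³ and
8×8–10×10 tori shell by shell, exact Tonks rings N = 11–41, thermal ideal gas, Maxwellian impostor):
an L-GROWING ratio S(1)/S(2) in 3-D retires PhononFloor in the filed form; a bounded one fixes C.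
(iii) Pencil: number-conserving Bogoliubov (Gardiner 1997, doi:10.1103/physreva.56.1414)
lowest-shell correction — O(1/N), no L-growth expected. (iv) Lookup (Novelty): no printed 3-D T = 0
ground state with a momentum-space shoulder between 2π/L and 1/ξ.

NUMBERS. Units ħ = 2m = 1; μ = 8πρa, ξ = μ^{-1/2}, 1/ξ = 5.013√(ρa); window top k = K√ρ = θ√(ρa)
with K = θ√a, kξ = θ/5.013 (θ = 3.23 ⟺ E_k = μ ⟺ x = k²ξ² = √2 − 1, modal kinetic energy (3 −
2√2)μ/2 per mode); cube shell {|n|_∞ = r} has 24r² + 2 modes with |n|₂ ∈ [r, √3 r]. Bogoliubov: n_B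
= (x+1)/(2√(x²+2x)) − ½ ≈ 1/(2√2·kξ) (kξ ≪ 1), 1/(4x²) (kξ ≫ 1); S(1) ≈ 1.02 L/ξ; total depletion
(8/(3√π))√(ρa³)N = 1.505√(ρa³)N, all of it above kξ ≈ 0.3 except O(L/ξ) particles. Count: R =
KL√ρ/2π = θL/(2π·5.013ξ) (= 24 at θ = 3.2, L = 240ξ), m = ⌈R/2⌉ − 1, ε = 1/(8(2C+1)) (= 1/40 at C =
2), n₀ ≥ N − N/8 − m. Energy-window barrier: a window of M² gaps certifies ≤ N/(M+1)
(KineticGapLengthScalesNarrow (3)) — δ is after N in every item. GP-scale localisation inside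
MesoscopicTail: ℓ = Gξ, depletion fraction ≤ (G²/2c)(Y^{1/17} + a/b), Fourier-tail factor
4/(πK₀√ρ·ℓ) = 4·5.013/(π θ₁ G) with K₀ = θ₁√a. Items at open: 5 (3 cruxes, 1 support, 1 assembly).

DEFINITION REQUESTS. None blocking: PeriodicTrialState, periodicEnergy, periodicGroundStateEnergy,
cellOccupation, condensateOccupation, sideLength, scatteringLength, HasGroundStateBEC,
IsRepulsiveFiniteRange (PeriodicBoseGas.lean / BoseEinsteinCondensation.lean) and cellWave
(PeriodicBoseGasFourier.lean) exist (lean search --decl each). Plane-wave occupations are inlined as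
cellOccupation N L (L^{-3/2}·cellWave L n) Ψ.ψ exactly as in route BECIroning, so Parseval lemmas
are shared. Nice-to-have, not filed: a named `planeWaveOccupation` API with Σ_n = N and Σ_n k² = T
(BECIroning noted the same). No cite facts wanted: every engine named under MesoscopicTail is PROVED
in tree.

Novelty: Searches (2026-08-15, this planner; the card's mechhunt seat and triage-22 searches are recorded on
the card): `lit search --hybrid "momentum distribution dilute Bose gas ground state monotone phonon
regime k^2 n_k shell occupation condensation thermodynamic limit"` (15 textbook hits:
Griffin–Snoke–Stringari 1995, Pethick–Smith 2008, Griffin1993, LSSY2005 — physics of n_k, no order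
statements); `lit search --source crossref "momentum distribution Bose gas depletion"` (15: Chang et
al. PRL 2016/2023 k⁻⁴-tail measurement, Minguzzi–Vignolo–Tosi 2000 finite-T n_k, unitary-gas and 1-D
papers — no rigorous shape law); openalex / s2 / arxiv / zbmath legs: HTTP 429 or 0 rows; `lit
galaxy search "momentum distribution of a Bose gas" --star all` (1: Zhai, Ultracold Atomic Physics),
`"momentum distribution of the weakly interacting Bose gas" --star all` (0), `"quasicondensate"
--star pdf` (15 physics theses/papers on 1-D/2-D quasi-condensates — the impostor phenomenology,
low-d); `lit frontier AtomisticToContinuum --since 2023` (30 rows; BEC: arXiv:2510.20493 kinetic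
localisation via Poincaré inequalities, arXiv:2603.20776 Neumann propagation, arXiv:2605.06844 trial
states — all energy-window class, used here only INSIDE MesoscopicTail); in-tree: the 84 Theses
files of the sub by title and decl list — infrared inputs are BOUNDS (BECIroning, BECInfraredBound,
BECLaplacianL1, BECThomsonPrinciple, BECSectorPoincareTwoScale, BECGroundStateSOS) or closed
transport (BECPhononTransport); none  [refs: 2510.20493, 2603.20776, 2605.06844, 2011.10869, Griffin1993, LSSY2005, KennedyLiebShastry1988, GavoretNozieres1964, NepomnyashchiiNepomnyashchii1978, Fournais2020, Junge2026, Tan2008]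

Barriers (technique_class: shape-axiom, slope-floor, mode-counting, GP-localisation): - technique_class: shape-axiom, slope-floor, mode-counting, GP-localisation
- Literature.Barriers.AtomisticToContinuum.KineticGapLengthScales: evaded — the kinetic-gap /
localisation method is used ONLY at scale ℓ = Gξ (g = ρaℓ² fixed) inside MesoscopicTail, exactly the
regime where LSSY Thm 5.1 / Fournais Thm 1.2 are theorems; nothing is localised at scale L.
- Literature.Barriers.AtomisticToContinuum.KineticGapLengthScalesNarrow: every item quantifies ∃δ
AFTER N (below the Galilei-boost witnesses 4π²N/L² of conjunct (2)), so the items speak about the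
exact torus ground state; the thermodynamic-limit content sits in PhononFloor, a SHAPE hypothesis on
Ψ₀'s momentum distribution to be proved by non-energy means ((LC)/(S)/(V)) — outside the
energy-window class by construction; honest residue: a prover attacking PhononFloor from an o(N)-gap
energy window alone is blocked by conjunct (3).
- Literature.Barriers.AtomisticToContinuum.EnergyAsymptoticsWithoutCondensation: respected — no
energy asymptotics are matched to condensation, LHY never enters (only Thm 2.4 precision Y^{1/17}
and Thm 2.2 inside MesoscopicTail); the 1-D Lieb–Liniger witness HAS the floor but the shell count
is dimension-sharp (transport ∝ L in d = 1, log L in d = 2).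
- Literature.Barriers.AtomisticToContinuum.BogoliubovPerturbationInfrared: not engaged — no
expansion in the infrared; Bogoliubov is only the consistency anchor (E(k*) = μ, S(r) increasing)
and the reason floors of order < 3 are believed; Ginzburg-

History (route lifecycle, newest last):
- 2026-08-25T01:47:07Z · DORMANT — reconciler: no traction for 7.3 d (last activity item-evidence-added at 2026-08-17T18:55:01Z); parked, not closed — `ledger route dormant route-AtomisticToConti (operator:999:486941)
- 2026-08-29T03:26:29Z · REACTIVATED — reconciler: reactivated — activity statement-checked at 2026-08-29T01:17:37Z after parking at 2026-08-25T01:47:07Z (operator:999:145135)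

sub-problem: BoseEinsteinCondensation · status: open · opened planner-plancard-AtomisticToContinuum-BoseEin-7e66f830-0 2026-08-15T18:04:44Z · rev 3 · ledger route-AtomisticToContinuum-BECPhononFloor
GENERATED by the gate from the ledger (D-0016/17). Provers cite these decls: `theorem foo : Summit.AtomisticToContinuum.BoseEinsteinCondensation.Theses.BECPhononFloor.<Decl> := …` in Summits/AtomisticToContinuum/BoseEinsteinCondensation/Theorems/<Name>.lean.
-/

namespace Summit.AtomisticToContinuum.BoseEinsteinCondensation.Theses.BECPhononFloor

open scoped BigOperators Topology Manifold Classical MeasureTheory ProbabilityTheory Matrix InnerProductSpace ComplexConjugate ContinuousMap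
open Filter Set Function TopologicalSpace MeasureTheory

attribute [summit_statement] _root_.BoseEinsteinCondensation

/-- item stmt-AtomisticToContinuum-11453 · crux · rank 2 · open · by planner
why it might fail: Open beyond Bogoliubov: no rigorous control of n_k for 2π/L ≤ k ≲ 1/ξ in the TL (print: GP/κ<2/5 boxes). An L-growing lowest-shell pile-up (n_{2π/L} ≫ L/ξ, generalised condensate between ξ and L) costs O(ρ^{2/3}) total energy, so nothing proved excludes it; unbounded NN-logs would also break C.
sources: GavoretNozieres1964, NepomnyashchiiNepomnyashchii1978, PitaevskiiStringari1991, Griffin1993, PuleZagrebnov2004, LSSY2005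
[crux] (card K1, thin-cube-shell form recommended by triage-22) for every repulsive finite-range
radial v there are K > 0 (physically K = θ√a, θ ≲ 3.2 ⟺ E_k ≤ μ at the window top), C > 0 and ρ₀ > 0
such that for all 0 < ρ < ρ₀, eventually in N, there is δ > 0 with: every periodic C¹ trial state Ψ
on the torus of side L = (N/ρ)^{1/3} with periodicEnergy v Ψ ≤ E₀^per(N, L) + δ satisfies, for all
integers 1 ≤ r ≤ s with s ≤ K L√ρ/(2π), Σ_{|n|_∞ = r} n_Ψ(n) ≤ C · Σ_{|n|_∞ = s} n_Ψ(n) + 1, where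
n_Ψ(n) = ⟨φ_n, γ_Ψ φ_n⟩ = cellOccupation of L^{-3/2} cellWave L n and {|n|_∞ = r} = cube(r) \
cube(r−1). δ is chosen AFTER N (an exact-ground-state property; below the Galilei-boost witnesses);
the +1 absorbs exactly-empty shells (v = 0 a.e.: T ≤ δ makes every shell ≤ 1). Bogoliubov-consistent
with C = 2 for θ ≤ 3.2 including the factor ≤ 3.25 of sup-norm shell geometry (§ Cheapest
falsifier). [difficulty: open-problem] -/
@[route_item "route-AtomisticToContinuum-BECPhononFloor", crux]
def PhononFloor : Prop :=
  ∀ v : ℝ → ENNReal, Literature.MathematicalPhysics.QuantumManyBody.BoseGas.IsRepulsiveFiniteRange v → ∃ K : ℝ, 0 < K ∧ ∃ C : ℝ, 0 < C ∧ ∃ ρ₀ : ℝ, 0 < ρ₀ ∧ ∀ ρ : ℝ, 0 < ρ → ρ < ρ₀ → ∀ᶠ N : ℕ in Filter.atTop, ∃ δ : ENNReal, 0 < δ ∧ ∀ Ψ : Literature.MathematicalPhysics.QuantumManyBody.BoseGas.PeriodicTrialState N (Literature.MathematicalPhysics.QuantumManyBody.BoseGas.sideLength ρ N), Literature.MathematicalPhysics.QuantumManyBody.BoseGas.periodicEnergy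 v Ψ ≤ Literature.MathematicalPhysics.QuantumManyBody.BoseGas.periodicGroundStateEnergy v N (Literature.MathematicalPhysics.QuantumManyBody.BoseGas.sideLength ρ N) + δ → ∀ r s : ℕ, 1 ≤ r → r ≤ s → (s : ℝ) ≤ K * Literature.MathematicalPhysics.QuantumManyBody.BoseGas.sideLength ρ N * Real.sqrt ρ / (2 * Real.pi) → (∑ n ∈ (Finset.Icc (fun _ : Fin 3 => -((r : ℤ))) (fun _ : Fin 3 => ((r : ℤ))) \ Finset.Icc (fun _ : Fin 3 => -((r : ℤ) - 1)) (fun _ : Fin 3 => ((r : ℤ) - 1))), Literature.MathematicalPhysics.QuantumManyBody.BoseGas.cellOccupation N (Literature.MathematicalPhysics.QuantumManyBody.BoseGas.sideLength ρ N) (fun x => ((Real.sqrt (Literature.MathematicalPhysics.QuantumManyBody.BoseGas.sideLength ρ N ^ 3))⁻¹ : ℂ) * Literature.MathematicalPhysics.QuantumManyBody.BoseGas.cellWave (Literature.MathematicalPhysics.QuantumManyBody.BoseGas.sideLength ρ N) n x) Ψ.ψ) ≤ ENNReal.ofReal C * (∑ n ∈ (Finset.Icc (fun _ : Fin 3 =>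 -((s : ℤ))) (fun _ : Fin 3 => ((s : ℤ))) \ Finset.Icc (fun _ : Fin 3 => -((s : ℤ) - 1)) (fun _ : Fin 3 => ((s : ℤ) - 1))), Literature.MathematicalPhysics.QuantumManyBody.BoseGas.cellOccupation N (Literature.MathematicalPhysics.QuantumManyBody.BoseGas.sideLength ρ N) (fun x => ((Real.sqrt (Literature.MathematicalPhysics.QuantumManyBody.BoseGas.sideLength ρ N ^ 3))⁻¹ : ℂ) * Literature.MathematicalPhysics.QuantumManyBody.BoseGas.cellWave (Literature.MathematicalPhysics.QuantumManyBody.BoseGas.sideLength ρ N) n x) Ψ.ψ) + 1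

/-- item stmt-AtomisticToContinuum-11454 · crux · rank 3 · open · by planner
why it might fail: Not in print for thermodynamic-box states: needs Thm 5.1-type local BEC on GP-scale Neumann sub-boxes ℓ=Gξ (G(K₀,ε)→∞ as K₀→0) of a canonical torus near-minimiser, uniform over atypical n_B, hard cores included; print stops at box problems (LSSY p.35: scale ρ^{-1/3}Y^{-1/17} ≪ ξ; CLN/Junge: κ<2/3).
sources: LSSY2005, LiebSeiringer2002, Fournais2020, ChongLiangNam2026, Junge2026, Literature.MathematicalPhysics.QuantumManyBody.BoseGas.LSSY2005_lemma52_periodic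
[crux] (card P4, the energy side; ∀ε-form needed by the count) for every repulsive finite-range
radial v and all K₀ > 0, ε > 0 there is ρ₀ > 0 such that for all 0 < ρ < ρ₀, eventually in N, there
is δ > 0 with: every periodic δ-near-minimiser Ψ on the torus of side L = (N/ρ)^{1/3} has Σ_{n ∈
cube(M) \ cube(m)} n_Ψ(n) ≤ εN for all integers m, M with m + 1 ≥ K₀ L√ρ/(2π) — i.e. the plane waves
with (2π/L)|n|_∞ ≥ K₀√ρ (a fixed fraction K₀/√(8πa) of the inverse healing length and everything
above, UV included) carry at most εN particles. Intended proof from PROVED cone facts only: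
Neumann-bracket the torus into boxes of side ℓ = Gξ, G = G(K₀, a, ε) fixed (GP scale, g = ρaℓ² =
G²/8π); global energy ≤ 4πρ₁aN(1 + C a/b) (LSSY2005_upperBound_periodic_holds) against Σ_boxes
LSSY2005_lowerBound_neumann_holds with LY superadditivity (2.52)–(2.64) ⟹ Σ_B (n_B − ρℓ³)² and Σ_B
(local excess) are o(ρaN)·ℓ³/a-controlled; LSSY Lemma 4.1 + 5.2 per box (lemma41_holds,
lemma52_periodic_holds; Fournais2020_condensation_holds beyond) ⟹ Σ_B tr(Q_B γ_Ψ) ≤ (G²/2c)(Y^{1/17}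
+ a/b)N; finally Σ_{|n|_∞ ≥ m+1} n_Ψ ≤ 2‖Π_{≥K₀√ρ} E_ℓ‖²·N + 2 Σ_B tr(Q_B γ_Ψ) with ‖Π_{≥K} E_ℓ‖² ≤
4/(πKℓ) for the coarse-graining E_ℓ o -/
@[route_item "route-AtomisticToContinuum-BECPhononFloor", crux]
def MesoscopicTail : Prop :=
  ∀ v : ℝ → ENNReal, Literature.MathematicalPhysics.QuantumManyBody.BoseGas.IsRepulsiveFiniteRange v → ∀ K₀ : ℝ, 0 < K₀ → ∀ ε : ℝ, 0 < ε → ∃ ρ₀ : ℝ, 0 < ρ₀ ∧ ∀ ρ : ℝ, 0 < ρ → ρ < ρ₀ → ∀ᶠ N : ℕ in Filter.atTop, ∃ δ : ENNReal, 0 < δ ∧ ∀ Ψ : Literature.MathematicalPhysics.QuantumManyBody.BoseGas.PeriodicTrialState N (Literature.MathematicalPhysics.QuantumManyBody.BoseGas.sideLength ρ N), Literature.MathematicalPhysics.QuantumManyBody.BoseGas.periodicEnergy v Ψ ≤ Literature.MathematicalPhysics.QuantumManyBody.BoseGas.periodicGroundStateEnergy v N (Literature.MathematicalPhysics.QuantumManyBody.BoseGas.sideLength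 ρ N) + δ → ∀ m M : ℕ, K₀ * Literature.MathematicalPhysics.QuantumManyBody.BoseGas.sideLength ρ N * Real.sqrt ρ / (2 * Real.pi) ≤ (m : ℝ) + 1 → (∑ n ∈ Finset.Icc (fun _ : Fin 3 => -((M : ℤ))) (fun _ : Fin 3 => ((M : ℤ))) \ Finset.Icc (fun _ : Fin 3 => -((m : ℤ))) (fun _ : Fin 3 => ((m : ℤ))), Literature.MathematicalPhysics.QuantumManyBody.BoseGas.cellOccupation N (Literature.MathematicalPhysics.QuantumManyBody.BoseGas.sideLength ρ N) (fun x => ((Real.sqrt (Literature.MathematicalPhysics.QuantumManyBody.BoseGas.sideLength ρ N ^ 3))⁻¹ : ℂ) * Literature.MathematicalPhysics.QuantumManyBody.BoseGas.cellWave (Literature.MathematicalPhysics.QuantumManyBody.BoseGas.sideLength ρ N) n x) Ψ.ψ) ≤ ENNReal.ofReal (ε * N)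

/-- item stmt-AtomisticToContinuum-0827 · crux · rank 4 · open · by planner
why it might fail: Torus hypothesis (δ after N: exact ground state) never fires on the Dirichlet ground state or its interior restrictions (not periodic, not sharp-N; wall energy ≫ N/L² ≫ δ): no energy comparison, only e₀^per = e₀^Dir is proved; needs an unprinted transfer (Neumann bracketing + λ_max ≥ tr γ²/N).
sources: LSSY2005, Robinson1976, BoccatoSeiringer2023, Junge2026, Fournais2020, Basti2022
[crux] BoundaryTransferWeak (mode-free boundary-condition transfer, per potential): for each
repulsive finite-range v, PeriodicBEC(v) implies ∃ρ₀>0 ∀ρ∈(0,ρ₀) HasGroundStateBEC v ρ (Dirichlet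
ground state, λ_max(γ) ≥ cN via condensateNumber). Not glue: near-minimiser slacks are O(N/L²) while
Dirichlet/periodic energies differ by a boundary term ≫ N/L², so no energy-comparison proof;
expected route: Neumann bracketing of interior sub-boxes (−Δ_Dir ≥ ⊕−Δ_Neu, v ≥ 0) + a mode-free
criterion (λ_max ≥ tr γ²/N). Only the ENERGY analogue is in print (LiebSeiringerSolovejYngvason2005
Ch. 2 after (2.8)). v ≡ 0: hypothesis and conclusion both true. -/
@[route_item "route-AtomisticToContinuum-BECPhononFloor", crux]
def BoundaryTransferWeak : Prop :=
  ∀ v : ℝ → ENNReal, Literature.MathematicalPhysics.QuantumManyBody.BoseGas.IsRepulsiveFiniteRange v → (∃ ρ₀ : ℝ, 0 < ρ₀ ∧ ∀ ρ : ℝ, 0 < ρ → ρ < ρ₀ → ∃ c : ℝ, 0 < c ∧ ∀ᶠ N : ℕ in Filter.atTop, ∃ δ : ENNReal, 0 < δ ∧ ∀ Ψ : Literature.MathematicalPhysics.QuantumManyBody.BoseGas.PeriodicTrialState N (Literature.MathematicalPhysics.QuantumManyBody.BoseGas.sideLength ρ N), Literature.MathematicalPhysics.QuantumManyBody.BoseGas.periodicEnergy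 v Ψ ≤ Literature.MathematicalPhysics.QuantumManyBody.BoseGas.periodicGroundStateEnergy v N (Literature.MathematicalPhysics.QuantumManyBody.BoseGas.sideLength ρ N) + δ → ENNReal.ofReal (c * N) ≤ Literature.MathematicalPhysics.QuantumManyBody.BoseGas.condensateOccupation N (Literature.MathematicalPhysics.QuantumManyBody.BoseGas.sideLength ρ N) Ψ.ψ) → ∃ ρ₀ : ℝ, 0 < ρ₀ ∧ ∀ ρ : ℝ, 0 < ρ → ρ < ρ₀ → Literature.MathematicalPhysics.QuantumManyBody.BoseGas.HasGroundStateBEC v ρ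

/-- item stmt-AtomisticToContinuum-11455 · support · rank 9 · closed · proved by Summit.AtomisticToContinuum.BoseEinsteinCondensation.Theorems.FloorModeCounting_proof (prover) · by planner
sources: LSSY2005, KennedyLiebShastry1988, Literature.MathematicalPhysics.QuantumManyBody.BoseGas.tsum_sq_cellFourierCoeff
[support] for each repulsive finite-range v: [PhononFloor body for v] → [MesoscopicTail body for v]
→ [PeriodicBEC body for v, c = 1/2] (stmt-0826 shape = the hypothesis of BoundaryTransferWeak).
Proof on paper, every input in tree: take K, C from PhononFloor, apply MesoscopicTail with K₀ = K/2
and ε = 1/(8(2C + 1)), intersect the eventual-N sets and take δ = min(δ₁, δ₂). Put R = K L√ρ/2π (≥ 4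
eventually; = 0 if the floor window is void, then MesoscopicTail alone bounds Σ_{n≠0}), m = ⌈R/2⌉ −
1, W = {m+1, …, ⌊R⌋} (#W ≥ R/2 − 1). (1) Infrared shells 1 ≤ r ≤ m: PhononFloor against each s ∈ W
and averaging over W gives S(r) ≤ (C/#W) Σ_{s∈W} S(s) + 1 ≤ (C/#W)·εN + 1 (the W-shells lie in
cube(⌊R⌋) \ cube(m), bounded by MesoscopicTail), hence Σ_{r≤m} S(r) ≤ 2CεN + m. (2) Everything with
|n|_∞ > m: ≤ εN by MesoscopicTail, uniformly in the outer cutoff M. (3) Parseval per particle slice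
(tsum_sq_cellFourierCoeff of PeriodicBoseGasFourier; Tonelli): Σ_{n ∈ ℤ³} n_Ψ(n) = N, and n_Ψ(0) =
condensateOccupation (cellWave_zero). Hence n₀ ≥ N − (2C+1)εN − m ≥ N − N/8 − m ≥ N/2 eventually (m
= O(N^{1/3})). Heavy but routine Lean (Finset cube shells, ENNReal bookkeeping, tsum/Finset
splitting); no ope -/
@[route_item "route-AtomisticToContinuum-BECPhononFloor", crux]
def FloorModeCounting : Prop :=
  ∀ v : ℝ → ENNReal, Literature.MathematicalPhysics.QuantumManyBody.BoseGas.IsRepulsiveFiniteRange v → (∃ K : ℝ, 0 < K ∧ ∃ C : ℝ, 0 < C ∧ ∃ ρ₀ : ℝ, 0 < ρ₀ ∧ ∀ ρ : ℝ, 0 < ρ → ρ < ρ₀ → ∀ᶠ N : ℕ in Filter.atTop, ∃ δ : ENNReal, 0 < δ ∧ ∀ Ψ : Literature.MathematicalPhysics.QuantumManyBody.BoseGas.PeriodicTrialState N (Literature.MathematicalPhysics.QuantumManyBody.BoseGas.sideLength ρ N), Literature.MathematicalPhysics.QuantumManyBody.BoseGas.periodicEnergy v Ψ ≤ Literature.MathematicalPhysics.QuantumManyBody.BoseGas.periodicGroundStateEnergy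 v N (Literature.MathematicalPhysics.QuantumManyBody.BoseGas.sideLength ρ N) + δ → ∀ r s : ℕ, 1 ≤ r → r ≤ s → (s : ℝ) ≤ K * Literature.MathematicalPhysics.QuantumManyBody.BoseGas.sideLength ρ N * Real.sqrt ρ / (2 * Real.pi) → (∑ n ∈ (Finset.Icc (fun _ : Fin 3 => -((r : ℤ))) (fun _ : Fin 3 => ((r : ℤ))) \ Finset.Icc (fun _ : Fin 3 => -((r : ℤ) - 1)) (fun _ : Fin 3 => ((r : ℤ) - 1))), Literature.MathematicalPhysics.QuantumManyBody.BoseGas.cellOccupation N (Literature.MathematicalPhysics.QuantumManyBody.BoseGas.sideLength ρ N) (fun x => ((Real.sqrt (Literature.MathematicalPhysics.QuantumManyBody.BoseGas.sideLength ρ N ^ 3))⁻¹ : ℂ) * Literature.MathematicalPhysics.QuantumManyBody.BoseGas.cellWave (Literature.MathematicalPhysics.QuantumManyBody.BoseGas.sideLength ρ N) n x) Ψ.ψ) ≤ ENNReal.ofReal C * (∑ n ∈ (Finset.Icc (fun _ : Fin 3 => -((s : ℤ))) (fun _ : Fin 3 => ((s : ℤ))) \ Finset.Icc (fun _ : Fin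 3 => -((s : ℤ) - 1)) (fun _ : Fin 3 => ((s : ℤ) - 1))), Literature.MathematicalPhysics.QuantumManyBody.BoseGas.cellOccupation N (Literature.MathematicalPhysics.QuantumManyBody.BoseGas.sideLength ρ N) (fun x => ((Real.sqrt (Literature.MathematicalPhysics.QuantumManyBody.BoseGas.sideLength ρ N ^ 3))⁻¹ : ℂ) * Literature.MathematicalPhysics.QuantumManyBody.BoseGas.cellWave (Literature.MathematicalPhysics.QuantumManyBody.BoseGas.sideLength ρ N) n x) Ψ.ψ) + 1) → (∀ K₀ : ℝ, 0 < K₀ → ∀ ε : ℝ, 0 < ε → ∃ ρ₀ : ℝ, 0 < ρ₀ ∧ ∀ ρ : ℝ, 0 < ρ → ρ < ρ₀ → ∀ᶠ N : ℕ in Filter.atTop, ∃ δ : ENNReal, 0 < δ ∧ ∀ Ψ : Literature.MathematicalPhysics.QuantumManyBody.BoseGas.PeriodicTrialState N (Literature.MathematicalPhysics.QuantumManyBody.BoseGas.sideLength ρ N), Literature.MathematicalPhysics.QuantumManyBody.BoseGas.periodicEnergy v Ψ ≤ Literature.MathematicalPhysics.QuantumManyBody.BoseGas.periodicGroundStateEnergy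 v N (Literature.MathematicalPhysics.QuantumManyBody.BoseGas.sideLength ρ N) + δ → ∀ m M : ℕ, K₀ * Literature.MathematicalPhysics.QuantumManyBody.BoseGas.sideLength ρ N * Real.sqrt ρ / (2 * Real.pi) ≤ (m : ℝ) + 1 → (∑ n ∈ Finset.Icc (fun _ : Fin 3 => -((M : ℤ))) (fun _ : Fin 3 => ((M : ℤ))) \ Finset.Icc (fun _ : Fin 3 => -((m : ℤ))) (fun _ : Fin 3 => ((m : ℤ))), Literature.MathematicalPhysics.QuantumManyBody.BoseGas.cellOccupation N (Literature.MathematicalPhysics.QuantumManyBody.BoseGas.sideLength ρ N) (fun x => ((Real.sqrt (Literature.MathematicalPhysics.QuantumManyBody.BoseGas.sideLength ρ N ^ 3))⁻¹ : ℂ) * Literature.MathematicalPhysics.QuantumManyBody.BoseGas.cellWave (Literature.MathematicalPhysics.QuantumManyBody.BoseGas.sideLength ρ N) n x) Ψ.ψ) ≤ ENNReal.ofReal (ε * N)) → ∃ ρ₀ : ℝ, 0 < ρ₀ ∧ ∀ ρ : ℝ, 0 < ρ → ρ < ρ₀ → ∃ c : ℝ, 0 < c ∧ ∀ᶠ N :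 ℕ in Filter.atTop, ∃ δ : ENNReal, 0 < δ ∧ ∀ Ψ : Literature.MathematicalPhysics.QuantumManyBody.BoseGas.PeriodicTrialState N (Literature.MathematicalPhysics.QuantumManyBody.BoseGas.sideLength ρ N), Literature.MathematicalPhysics.QuantumManyBody.BoseGas.periodicEnergy v Ψ ≤ Literature.MathematicalPhysics.QuantumManyBody.BoseGas.periodicGroundStateEnergy v N (Literature.MathematicalPhysics.QuantumManyBody.BoseGas.sideLength ρ N) + δ → ENNReal.ofReal (c * N) ≤ Literature.MathematicalPhysics.QuantumManyBody.BoseGas.condensateOccupation N (Literature.MathematicalPhysics.QuantumManyBody.BoseGas.sideLength ρ N) Ψ.ψ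

-- `FloorModeCounting` holds: proved by `Summit.AtomisticToContinuum.BoseEinsteinCondensation.Theorems.FloorModeCounting_proof` (its module imports this route file, so no `_holds` link can be stated here).

/-- item stmt-AtomisticToContinuum-11456 · assembly · rank 1 · closed · proved by Summit.AtomisticToContinuum.BoseEinsteinCondensation.Theorems.becPhononFloor_assembly_proof (prover) · by planner
sources: LSSY2005, KennedyLiebShastry1988
[assembly] PhononFloor → MesoscopicTail → FloorModeCounting → BoundaryTransferWeak →
BoseEinsteinCondensation. -/
@[route_item "route-AtomisticToContinuum-BECPhononFloor"]
def Assembly : Prop :=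
  PhononFloor → MesoscopicTail → FloorModeCounting → BoundaryTransferWeak → BoseEinsteinCondensation

-- `Assembly` holds: proved by `Summit.AtomisticToContinuum.BoseEinsteinCondensation.Theorems.becPhononFloor_assembly_proof` (its module imports this route file, so no `_holds` link can be stated here).

/-! D-0027 §2.1 — DECIDING THEOREM (planner-authored via `route open/edit --closes-file`; by planner-plancard-AtomisticToContinuum-BoseEin-7e66f830-0 2026-08-15T18:04:45Z):
its hypotheses are this route's items and its conclusion the sub-problem Statement (glue_lint), and it elaborates with this file. -/

@[closes "route-AtomisticToContinuum-BECPhononFloor"] theorem closes (h1 : PhononFloor) (h2 : MesoscopicTail) (h3 : FloorModeCounting) (h4 : BoundaryTransferWeak) : BoseEinsteinCondensation :=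
  fun v hv => h4 v hv (h3 v hv (h1 v hv) (h2 v hv))

end Summit.AtomisticToContinuum.BoseEinsteinCondensation.Theses.BECPhononFloor
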